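import Summits.BirchSwinnertonDyer.BirchSwinnertonDyer.Theorems.ManinLocalTwoThreeEtaBasisFiftyTwoE
import Summits.BirchSwinnertonDyer.BirchSwinnertonDyer.Theorems.ManinLocalTwoThreeEtaFrickeLaw
import HarnessLib

/-!
# Level 52 (C2 domain, genus 5), part 2e: `w₅₂` on the `σ`-closed `η`-basis — ten instances of the `η`-Fricke law

Cell `bsd-f2-manin`, route `ManinLocalTwoThree`, crux C2 `ManinOddAtFour` (stmt-BirchSwinnertonDyer-22967), LEAD p1 gen 24;
`--supports stmt-BirchSwinnertonDyer-22967` (helper).  For each basis form `Cᵢ` of `…EtaBasisFiftyTwoA…E`: `Σ_δ r_δ = 4`, the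
reflected exponent vector `r^σ` is that of `C_{σ(i)}` on the divisors of `52` (`σ`: `C₃ ↔ C₄`, `C₅ ↔ C₆`, `C₇ ↔ C₈`, `C₉ ↔ C₁₀`,
`C₁, C₂` fixed), the Fricke constant `K ∈ {1, 1, 1/16, 16, 13/16, 16/13, 1/4, 4, 1/4, 4}` (`etaFrickeConst_eq_of_sq`), hence
`Cᵢ ∣₂ w₅₂ = −Kᵢ · C_{σ(i)}` (`slash_C1 … slash_C10`, from `EtaFricke.etaQuotient_slash_frickeGL`).  Data: an g51 `scripts/l52c.out`.
Nothing here proves C2, Manin's conjecture or BSD. [cite: AtkinLehner1970, Thm. 3] [cite: Koehler2011, Ch. 2]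
-/

set_option autoImplicit false
-- lint-debt: the directory name repeats the summit name (sibling precedent `ManinLocalTwoThreeEtaFrickeLaw.lean`)
set_option linter.dupNamespace false

noncomputable section

open Complex
open UpperHalfPlane hiding I
open scoped MatrixGroups ModularForm
open ModularForm CongruenceSubgroup
open Literature.NumberTheory.ModularForms
open Literature.NumberTheory.EllipticCurves Literature.NumberTheory.EllipticCurves.ModularForms

namespace Summit.BirchSwinnertonDyer.BirchSwinnertonDyer.Theorems.ManinLocalTwoThree.LevelFiftyTwo

open EtaFricke

/-! ## §2 `w₅₂` on the `σ`-closed basis: a signed scalar permutation -/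

/-- `Σ_δ r_δ(C1) = 4` (weight `2`). [folklore] -/
theorem sum_rC1 : ∑ δ ∈ (52 : ℕ).divisors, rC1 δ = 4 := by unfold rC1; decide

/-- The reflected exponent vector of `C1` is that of `C1` on the divisors of `52`. [folklore] -/
theorem frickeExp_rC1 : ∀ δ ∈ (52 : ℕ).divisors, frickeExp 52 rC1 δ = rC1 δ := by
  unfold frickeExp rC1; decide

/-- The Fricke constant of `C1`: `K = 1` (`∏ δ^{r_δ} = (52/K)²`). [folklore] -/
theorem etaFrickeConst_rC1 : etaFrickeConst 52 rC1 = (1 : ℝ) := by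
  refine etaFrickeConst_eq_of_sq 52 rC1 sum_rC1 (by norm_num) ?_
  rw [show (52 : ℕ).divisors = {1, 2, 4, 13, 26, 52} from by decide]
  rw [Finset.prod_insert (by decide), Finset.prod_insert (by decide), Finset.prod_insert (by decide),
    Finset.prod_insert (by decide), Finset.prod_insert (by decide), Finset.prod_singleton]
  have e : rC1 1 = 1 ∧ rC1 2 = -2 ∧ rC1 4 = 3 ∧ rC1 13 = 3 ∧ rC1 26 = -2 ∧ rC1 52 = 1 := by
    unfold rC1; decide
  obtain ⟨e1, e2, e4, e13, e26, e52⟩ := e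
  rw [e1, e2, e4, e13, e26, e52]
  norm_num

/-- `Σ_δ r_δ(C2) = 4` (weight `2`). [folklore] -/
theorem sum_rC2 : ∑ δ ∈ (52 : ℕ).divisors, rC2 δ = 4 := by unfold rC2; decide

/-- The reflected exponent vector of `C2` is that of `C2` on the divisors of `52`. [folklore] -/
theorem frickeExp_rC2 : ∀ δ ∈ (52 : ℕ).divisors, frickeExp 52 rC2 δ = rC2 δ := by
  unfold frickeExp rC2; decide

/-- The Fricke constant of `C2`: `K = 1` (`∏ δ^{r_δ} = (52/K)²`). [folklore] -/
theorem etaFrickeConst_rC2 : etaFrickeConst 52 rC2 = (1 : ℝ) := by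
  refine etaFrickeConst_eq_of_sq 52 rC2 sum_rC2 (by norm_num) ?_
  rw [show (52 : ℕ).divisors = {1, 2, 4, 13, 26, 52} from by decide]
  rw [Finset.prod_insert (by decide), Finset.prod_insert (by decide), Finset.prod_insert (by decide),
    Finset.prod_insert (by decide), Finset.prod_insert (by decide), Finset.prod_singleton]
  have e : rC2 1 = 3 ∧ rC2 2 = -2 ∧ rC2 4 = 1 ∧ rC2 13 = 1 ∧ rC2 26 = -2 ∧ rC2 52 = 3 := by
    unfold rC2; decide
  obtain ⟨e1, e2, e4, e13, e26, e52⟩ := e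
  rw [e1, e2, e4, e13, e26, e52]
  norm_num

/-- `Σ_δ r_δ(C3) = 4` (weight `2`). [folklore] -/
theorem sum_rC3 : ∑ δ ∈ (52 : ℕ).divisors, rC3 δ = 4 := by unfold rC3; decide

/-- The reflected exponent vector of `C3` is that of `C4` on the divisors of `52`. [folklore] -/
theorem frickeExp_rC3 : ∀ δ ∈ (52 : ℕ).divisors, frickeExp 52 rC3 δ = rC4 δ := by
  unfold frickeExp rC3 rC4; decide

/-- The Fricke constant of `C3`: `K = 1/16` (`∏ δ^{r_δ} = (52/K)²`). [folklore] -/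
theorem etaFrickeConst_rC3 : etaFrickeConst 52 rC3 = ((1 : ℝ) / 16) := by
  refine etaFrickeConst_eq_of_sq 52 rC3 sum_rC3 (by norm_num) ?_
  rw [show (52 : ℕ).divisors = {1, 2, 4, 13, 26, 52} from by decide]
  rw [Finset.prod_insert (by decide), Finset.prod_insert (by decide), Finset.prod_insert (by decide),
    Finset.prod_insert (by decide), Finset.prod_insert (by decide), Finset.prod_singleton]
  have e : rC3 1 = 0 ∧ rC3 2 = -2 ∧ rC3 4 = 4 ∧ rC3 13 = 0 ∧ rC3 26 = -2 ∧ rC3 52 = 4 := by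
    unfold rC3; decide
  obtain ⟨e1, e2, e4, e13, e26, e52⟩ := e
  rw [e1, e2, e4, e13, e26, e52]
  norm_num

/-- `Σ_δ r_δ(C4) = 4` (weight `2`). [folklore] -/
theorem sum_rC4 : ∑ δ ∈ (52 : ℕ).divisors, rC4 δ = 4 := by unfold rC4; decide

/-- The reflected exponent vector of `C4` is that of `C3` on the divisors of `52`. [folklore] -/
theorem frickeExp_rC4 : ∀ δ ∈ (52 : ℕ).divisors, frickeExp 52 rC4 δ = rC3 δ := by
  unfold frickeExp rC4 rC3; decide

/-- The Fricke constant of `C4`: `K = 16` (`∏ δ^{r_δ} = (52/K)²`). [folklore] -/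
theorem etaFrickeConst_rC4 : etaFrickeConst 52 rC4 = (16 : ℝ) := by
  refine etaFrickeConst_eq_of_sq 52 rC4 sum_rC4 (by norm_num) ?_
  rw [show (52 : ℕ).divisors = {1, 2, 4, 13, 26, 52} from by decide]
  rw [Finset.prod_insert (by decide), Finset.prod_insert (by decide), Finset.prod_insert (by decide),
    Finset.prod_insert (by decide), Finset.prod_insert (by decide), Finset.prod_singleton]
  have e : rC4 1 = 4 ∧ rC4 2 = -2 ∧ rC4 4 = 0 ∧ rC4 13 = 4 ∧ rC4 26 = -2 ∧ rC4 52 = 0 := by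
    unfold rC4; decide
  obtain ⟨e1, e2, e4, e13, e26, e52⟩ := e
  rw [e1, e2, e4, e13, e26, e52]
  norm_num

/-- `Σ_δ r_δ(C5) = 4` (weight `2`). [folklore] -/
theorem sum_rC5 : ∑ δ ∈ (52 : ℕ).divisors, rC5 δ = 4 := by unfold rC5; decide

/-- The reflected exponent vector of `C5` is that of `C6` on the divisors of `52`. [folklore] -/
theorem frickeExp_rC5 : ∀ δ ∈ (52 : ℕ).divisors, frickeExp 52 rC5 δ = rC6 δ := by
  unfold frickeExp rC5 rC6; decide

/-- The Fricke constant of `C5`: `K = 13/16` (`∏ δ^{r_δ} = (52/K)²`). [folklore] -/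
theorem etaFrickeConst_rC5 : etaFrickeConst 52 rC5 = ((13 : ℝ) / 16) := by
  refine etaFrickeConst_eq_of_sq 52 rC5 sum_rC5 (by norm_num) ?_
  rw [show (52 : ℕ).divisors = {1, 2, 4, 13, 26, 52} from by decide]
  rw [Finset.prod_insert (by decide), Finset.prod_insert (by decide), Finset.prod_insert (by decide),
    Finset.prod_insert (by decide), Finset.prod_insert (by decide), Finset.prod_singleton]
  have e : rC5 1 = 0 ∧ rC5 2 = -4 ∧ rC5 4 = 8 ∧ rC5 13 = 0 ∧ rC5 26 = 0 ∧ rC5 52 = 0 := by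
    unfold rC5; decide
  obtain ⟨e1, e2, e4, e13, e26, e52⟩ := e
  rw [e1, e2, e4, e13, e26, e52]
  norm_num

/-- `Σ_δ r_δ(C6) = 4` (weight `2`). [folklore] -/
theorem sum_rC6 : ∑ δ ∈ (52 : ℕ).divisors, rC6 δ = 4 := by unfold rC6; decide

/-- The reflected exponent vector of `C6` is that of `C5` on the divisors of `52`. [folklore] -/
theorem frickeExp_rC6 : ∀ δ ∈ (52 : ℕ).divisors, frickeExp 52 rC6 δ = rC5 δ := by
  unfold frickeExp rC6 rC5; decide

/-- The Fricke constant of `C6`: `K = 16/13` (`∏ δ^{r_δ} = (52/K)²`). [folklore] -/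
theorem etaFrickeConst_rC6 : etaFrickeConst 52 rC6 = ((16 : ℝ) / 13) := by
  refine etaFrickeConst_eq_of_sq 52 rC6 sum_rC6 (by norm_num) ?_
  rw [show (52 : ℕ).divisors = {1, 2, 4, 13, 26, 52} from by decide]
  rw [Finset.prod_insert (by decide), Finset.prod_insert (by decide), Finset.prod_insert (by decide),
    Finset.prod_insert (by decide), Finset.prod_insert (by decide), Finset.prod_singleton]
  have e : rC6 1 = 0 ∧ rC6 2 = 0 ∧ rC6 4 = 0 ∧ rC6 13 = 8 ∧ rC6 26 = -4 ∧ rC6 52 = 0 := by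
    unfold rC6; decide
  obtain ⟨e1, e2, e4, e13, e26, e52⟩ := e
  rw [e1, e2, e4, e13, e26, e52]
  norm_num

/-- `Σ_δ r_δ(C7) = 4` (weight `2`). [folklore] -/
theorem sum_rC7 : ∑ δ ∈ (52 : ℕ).divisors, rC7 δ = 4 := by unfold rC7; decide

/-- The reflected exponent vector of `C7` is that of `C8` on the divisors of `52`. [folklore] -/
theorem frickeExp_rC7 : ∀ δ ∈ (52 : ℕ).divisors, frickeExp 52 rC7 δ = rC8 δ := by
  unfold frickeExp rC7 rC8; decide

/-- The Fricke constant of `C7`: `K = 1/4` (`∏ δ^{r_δ} = (52/K)²`). [folklore] -/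
theorem etaFrickeConst_rC7 : etaFrickeConst 52 rC7 = ((1 : ℝ) / 4) := by
  refine etaFrickeConst_eq_of_sq 52 rC7 sum_rC7 (by norm_num) ?_
  rw [show (52 : ℕ).divisors = {1, 2, 4, 13, 26, 52} from by decide]
  rw [Finset.prod_insert (by decide), Finset.prod_insert (by decide), Finset.prod_insert (by decide),
    Finset.prod_insert (by decide), Finset.prod_insert (by decide), Finset.prod_singleton]
  have e : rC7 1 = -1 ∧ rC7 2 = 1 ∧ rC7 4 = 2 ∧ rC7 13 = -3 ∧ rC7 26 = 7 ∧ rC7 52 = -2 := by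
    unfold rC7; decide
  obtain ⟨e1, e2, e4, e13, e26, e52⟩ := e
  rw [e1, e2, e4, e13, e26, e52]
  norm_num

/-- `Σ_δ r_δ(C8) = 4` (weight `2`). [folklore] -/
theorem sum_rC8 : ∑ δ ∈ (52 : ℕ).divisors, rC8 δ = 4 := by unfold rC8; decide

/-- The reflected exponent vector of `C8` is that of `C7` on the divisors of `52`. [folklore] -/
theorem frickeExp_rC8 : ∀ δ ∈ (52 : ℕ).divisors, frickeExp 52 rC8 δ = rC7 δ := by
  unfold frickeExp rC8 rC7; decide

/-- The Fricke constant of `C8`: `K = 4` (`∏ δ^{r_δ} = (52/K)²`). [folklore] -/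
theorem etaFrickeConst_rC8 : etaFrickeConst 52 rC8 = (4 : ℝ) := by
  refine etaFrickeConst_eq_of_sq 52 rC8 sum_rC8 (by norm_num) ?_
  rw [show (52 : ℕ).divisors = {1, 2, 4, 13, 26, 52} from by decide]
  rw [Finset.prod_insert (by decide), Finset.prod_insert (by decide), Finset.prod_insert (by decide),
    Finset.prod_insert (by decide), Finset.prod_insert (by decide), Finset.prod_singleton]
  have e : rC8 1 = -2 ∧ rC8 2 = 7 ∧ rC8 4 = -3 ∧ rC8 13 = 2 ∧ rC8 26 = 1 ∧ rC8 52 = -1 := by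
    unfold rC8; decide
  obtain ⟨e1, e2, e4, e13, e26, e52⟩ := e
  rw [e1, e2, e4, e13, e26, e52]
  norm_num

/-- `Σ_δ r_δ(C9) = 4` (weight `2`). [folklore] -/
theorem sum_rC9 : ∑ δ ∈ (52 : ℕ).divisors, rC9 δ = 4 := by unfold rC9; decide

/-- The reflected exponent vector of `C9` is that of `C10` on the divisors of `52`. [folklore] -/
theorem frickeExp_rC9 : ∀ δ ∈ (52 : ℕ).divisors, frickeExp 52 rC9 δ = rC10 δ := by
  unfold frickeExp rC9 rC10; decide

/-- The Fricke constant of `C9`: `K = 1/4` (`∏ δ^{r_δ} = (52/K)²`). [folklore] -/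
theorem etaFrickeConst_rC9 : etaFrickeConst 52 rC9 = ((1 : ℝ) / 4) := by
  refine etaFrickeConst_eq_of_sq 52 rC9 sum_rC9 (by norm_num) ?_
  rw [show (52 : ℕ).divisors = {1, 2, 4, 13, 26, 52} from by decide]
  rw [Finset.prod_insert (by decide), Finset.prod_insert (by decide), Finset.prod_insert (by decide),
    Finset.prod_insert (by decide), Finset.prod_insert (by decide), Finset.prod_singleton]
  have e : rC9 1 = -3 ∧ rC9 2 = 7 ∧ rC9 4 = -2 ∧ rC9 13 = -1 ∧ rC9 26 = 1 ∧ rC9 52 = 2 := by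
    unfold rC9; decide
  obtain ⟨e1, e2, e4, e13, e26, e52⟩ := e
  rw [e1, e2, e4, e13, e26, e52]
  norm_num

/-- `Σ_δ r_δ(C10) = 4` (weight `2`). [folklore] -/
theorem sum_rC10 : ∑ δ ∈ (52 : ℕ).divisors, rC10 δ = 4 := by unfold rC10; decide

/-- The reflected exponent vector of `C10` is that of `C9` on the divisors of `52`. [folklore] -/
theorem frickeExp_rC10 : ∀ δ ∈ (52 : ℕ).divisors, frickeExp 52 rC10 δ = rC9 δ := by
  unfold frickeExp rC10 rC9; decide

/-- The Fricke constant of `C10`: `K = 4` (`∏ δ^{r_δ} = (52/K)²`). [folklore] -/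
theorem etaFrickeConst_rC10 : etaFrickeConst 52 rC10 = (4 : ℝ) := by
  refine etaFrickeConst_eq_of_sq 52 rC10 sum_rC10 (by norm_num) ?_
  rw [show (52 : ℕ).divisors = {1, 2, 4, 13, 26, 52} from by decide]
  rw [Finset.prod_insert (by decide), Finset.prod_insert (by decide), Finset.prod_insert (by decide),
    Finset.prod_insert (by decide), Finset.prod_insert (by decide), Finset.prod_singleton]
  have e : rC10 1 = 2 ∧ rC10 2 = 1 ∧ rC10 4 = -1 ∧ rC10 13 = -2 ∧ rC10 26 = 7 ∧ rC10 52 = -3 := by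
    unfold rC10; decide
  obtain ⟨e1, e2, e4, e13, e26, e52⟩ := e
  rw [e1, e2, e4, e13, e26, e52]
  norm_num

/-- `η`-quotients of level `52` only see the exponents on the divisors of `52`. [folklore] -/
theorem etaQuotient_congr52 {r r' : ℕ → ℤ} (h : ∀ δ ∈ (52 : ℕ).divisors, r δ = r' δ) :
    etaQuotient 52 r = etaQuotient 52 r' := by
  funext τ
  rw [etaQuotient_apply, etaQuotient_apply]
  exact Finset.prod_congr rfl fun δ hδ ↦ by rw [h δ hδ]

/-- **`C1 ∣₂ w₅₂ = −1 · C1`.** [cite: AtkinLehner1970, Thm. 3] -/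
theorem slash_C1 : (⇑C1 : ℍ → ℂ) ∣[(2 : ℤ)] (glCast (frickeGL 52 : GL (Fin 2) ℚ) : GL (Fin 2) ℝ)
    = (-(1 : ℂ)) • (⇑C1 : ℍ → ℂ) := by
  rw [show (⇑C1 : ℍ → ℂ) = etaQuotient 52 rC1 from rfl,
    etaQuotient_slash_frickeGL 52 rC1 sum_rC1, etaFrickeConst_rC1, etaQuotient_congr52 frickeExp_rC1]
  norm_num

/-- **`C2 ∣₂ w₅₂ = −1 · C2`.** [cite: AtkinLehner1970, Thm. 3] -/
theorem slash_C2 : (⇑C2 : ℍ → ℂ) ∣[(2 : ℤ)] (glCast (frickeGL 52 : GL (Fin 2) ℚ) : GL (Fin 2) ℝ)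
    = (-(1 : ℂ)) • (⇑C2 : ℍ → ℂ) := by
  rw [show (⇑C2 : ℍ → ℂ) = etaQuotient 52 rC2 from rfl,
    etaQuotient_slash_frickeGL 52 rC2 sum_rC2, etaFrickeConst_rC2, etaQuotient_congr52 frickeExp_rC2]
  norm_num

/-- **`C3 ∣₂ w₅₂ = −1/16 · C4`.** [cite: AtkinLehner1970, Thm. 3] -/
theorem slash_C3 : (⇑C3 : ℍ → ℂ) ∣[(2 : ℤ)] (glCast (frickeGL 52 : GL (Fin 2) ℚ) : GL (Fin 2) ℝ)
    = (-((1 : ℂ) / 16)) • (⇑C4 : ℍ → ℂ) := by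
  rw [show (⇑C3 : ℍ → ℂ) = etaQuotient 52 rC3 from rfl, show (⇑C4 : ℍ → ℂ) = etaQuotient 52 rC4 from rfl,
    etaQuotient_slash_frickeGL 52 rC3 sum_rC3, etaFrickeConst_rC3, etaQuotient_congr52 frickeExp_rC3]
  norm_num

/-- **`C4 ∣₂ w₅₂ = −16 · C3`.** [cite: AtkinLehner1970, Thm. 3] -/
theorem slash_C4 : (⇑C4 : ℍ → ℂ) ∣[(2 : ℤ)] (glCast (frickeGL 52 : GL (Fin 2) ℚ) : GL (Fin 2) ℝ)
    = (-(16 : ℂ)) • (⇑C3 : ℍ → ℂ) := by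
  rw [show (⇑C4 : ℍ → ℂ) = etaQuotient 52 rC4 from rfl, show (⇑C3 : ℍ → ℂ) = etaQuotient 52 rC3 from rfl,
    etaQuotient_slash_frickeGL 52 rC4 sum_rC4, etaFrickeConst_rC4, etaQuotient_congr52 frickeExp_rC4]
  norm_num

/-- **`C5 ∣₂ w₅₂ = −13/16 · C6`.** [cite: AtkinLehner1970, Thm. 3] -/
theorem slash_C5 : (⇑C5 : ℍ → ℂ) ∣[(2 : ℤ)] (glCast (frickeGL 52 : GL (Fin 2) ℚ) : GL (Fin 2) ℝ)
    = (-((13 : ℂ) / 16)) • (⇑C6 : ℍ → ℂ) := by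
  rw [show (⇑C5 : ℍ → ℂ) = etaQuotient 52 rC5 from rfl, show (⇑C6 : ℍ → ℂ) = etaQuotient 52 rC6 from rfl,
    etaQuotient_slash_frickeGL 52 rC5 sum_rC5, etaFrickeConst_rC5, etaQuotient_congr52 frickeExp_rC5]
  norm_num

/-- **`C6 ∣₂ w₅₂ = −16/13 · C5`.** [cite: AtkinLehner1970, Thm. 3] -/
theorem slash_C6 : (⇑C6 : ℍ → ℂ) ∣[(2 : ℤ)] (glCast (frickeGL 52 : GL (Fin 2) ℚ) : GL (Fin 2) ℝ)
    = (-((16 : ℂ) / 13)) • (⇑C5 : ℍ → ℂ) := by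
  rw [show (⇑C6 : ℍ → ℂ) = etaQuotient 52 rC6 from rfl, show (⇑C5 : ℍ → ℂ) = etaQuotient 52 rC5 from rfl,
    etaQuotient_slash_frickeGL 52 rC6 sum_rC6, etaFrickeConst_rC6, etaQuotient_congr52 frickeExp_rC6]
  norm_num

/-- **`C7 ∣₂ w₅₂ = −1/4 · C8`.** [cite: AtkinLehner1970, Thm. 3] -/
theorem slash_C7 : (⇑C7 : ℍ → ℂ) ∣[(2 : ℤ)] (glCast (frickeGL 52 : GL (Fin 2) ℚ) : GL (Fin 2) ℝ)
    = (-((1 : ℂ) / 4)) • (⇑C8 : ℍ → ℂ) := by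
  rw [show (⇑C7 : ℍ → ℂ) = etaQuotient 52 rC7 from rfl, show (⇑C8 : ℍ → ℂ) = etaQuotient 52 rC8 from rfl,
    etaQuotient_slash_frickeGL 52 rC7 sum_rC7, etaFrickeConst_rC7, etaQuotient_congr52 frickeExp_rC7]
  norm_num

/-- **`C8 ∣₂ w₅₂ = −4 · C7`.** [cite: AtkinLehner1970, Thm. 3] -/
theorem slash_C8 : (⇑C8 : ℍ → ℂ) ∣[(2 : ℤ)] (glCast (frickeGL 52 : GL (Fin 2) ℚ) : GL (Fin 2) ℝ)
    = (-(4 : ℂ)) • (⇑C7 : ℍ → ℂ) := by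
  rw [show (⇑C8 : ℍ → ℂ) = etaQuotient 52 rC8 from rfl, show (⇑C7 : ℍ → ℂ) = etaQuotient 52 rC7 from rfl,
    etaQuotient_slash_frickeGL 52 rC8 sum_rC8, etaFrickeConst_rC8, etaQuotient_congr52 frickeExp_rC8]
  norm_num

/-- **`C9 ∣₂ w₅₂ = −1/4 · C10`.** [cite: AtkinLehner1970, Thm. 3] -/
theorem slash_C9 : (⇑C9 : ℍ → ℂ) ∣[(2 : ℤ)] (glCast (frickeGL 52 : GL (Fin 2) ℚ) : GL (Fin 2) ℝ)
    = (-((1 : ℂ) / 4)) • (⇑C10 : ℍ → ℂ) := by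
  rw [show (⇑C9 : ℍ → ℂ) = etaQuotient 52 rC9 from rfl, show (⇑C10 : ℍ → ℂ) = etaQuotient 52 rC10 from rfl,
    etaQuotient_slash_frickeGL 52 rC9 sum_rC9, etaFrickeConst_rC9, etaQuotient_congr52 frickeExp_rC9]
  norm_num

/-- **`C10 ∣₂ w₅₂ = −4 · C9`.** [cite: AtkinLehner1970, Thm. 3] -/
theorem slash_C10 : (⇑C10 : ℍ → ℂ) ∣[(2 : ℤ)] (glCast (frickeGL 52 : GL (Fin 2) ℚ) : GL (Fin 2) ℝ)
    = (-(4 : ℂ)) • (⇑C9 : ℍ → ℂ) := by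
  rw [show (⇑C10 : ℍ → ℂ) = etaQuotient 52 rC10 from rfl, show (⇑C9 : ℍ → ℂ) = etaQuotient 52 rC9 from rfl,
    etaQuotient_slash_frickeGL 52 rC10 sum_rC10, etaFrickeConst_rC10, etaQuotient_congr52 frickeExp_rC10]
  norm_num


end Summit.BirchSwinnertonDyer.BirchSwinnertonDyer.Theorems.ManinLocalTwoThree.LevelFiftyTwo

end
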